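import Literature.Geometry.Lorentzian.SenWittenSmoothness
import Literature.Geometry.Lorentzian.SenWittenFrameCalculus
import HarnessLib

/-!
# The structure equation of an orthonormal frame and the bracket of second derivatives

Sub-bricks (ii-b), (ii-c) of the Lichnerowicz identity in a frame (brick B1a of the analytic
engine of Witten's proof of the positive energy theorem, `SenWittenOperator.lean`), on a data
manifold `(X, h, k)` with a smooth global `h`-orthonormal frame `F` and connection coefficients
`ω_{kl}(v) = h(∇ᵥF_k, F_l)` (`SenWitten.connCoeff`):

* `SenWitten.val_eq_sum_frame` — `h(A, B) = Σₘ h(A, Fₘ) h(B, Fₘ)` (Parseval in the frame);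
* `SenWitten.structure_equation` — **Cartan's second structure equation in the frame**: for smooth
  vector fields `U`, `W`,
  `U(ω_{kl}(W)) − W(ω_{kl}(U)) − ω_{kl}([U, W]) = h(R(U,W)F_k, F_l)
     + Σₘ (ω_{km}(W) ω_{lm}(U) − ω_{km}(U) ω_{lm}(W))`
  (O'Neill 1983, Ch. 3, Lemma 3.35 with Thm. 3.11 (D4): `R(U,W)F_k = ∇_U∇_WF_k − ∇_W∇_UF_k − ∇_{[U,W]}F_k`
  paired with `F_l`, metric compatibility and the frame expansion);
* `SenWitten.mvfderiv_mvfderiv_sub_eq_mvfderiv_mlieBracket` — **the Lie bracket acts on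
  vector-valued functions as the commutator of the derivations**: for a smooth spinor field `ψ`,
  `U(Wψ) − W(Uψ) = [U, W]ψ` (componentwise from the scalar case
  `Literature.Geometry.Lorentzian.mvfderiv_apply_mlieBracket`).

All proved; no definitions, no named facts.

## References

* B. O'Neill, *Semi-Riemannian geometry*, Academic Press 1983, Ch. 3, Thm. 3.11, Lemma 3.35.
  [ONeill1983]
* T. Parker, C. H. Taubes, *On Witten's proof of the positive energy theorem*, Comm. Math. Phys.
  84 (1982) 223–238, §3 (the frame computation behind (3.1)). [ParkerTaubes1982]
-/

noncomputable section

open Bundle Set Function Manifold Finset Filter VectorField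
open scoped Manifold ContDiff Topology RealInnerProductSpace

namespace Literature.Geometry.Lorentzian

namespace SenWitten

open PauliModel

variable {X : Type*} [TopologicalSpace X] [ChartedSpace E3 X] [IsManifold (𝓡 3) ∞ X]
  (D : InitialDataSet (𝓡 3) X) (F : Fin 3 → Π x : X, TangentSpace (𝓡 3) x)

/-! ### Parseval in an orthonormal frame -/

/-- **Expansion of a tangent vector in the orthonormal frame**: `A = Σₘ h(A, Fₘ) Fₘ`. [folklore] -/
theorem eq_sum_frame {x : X}
    (horth : ∀ i j, D.h.inner x (F i x) (F j x) = if i = j then 1 else 0)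
    (A : TangentSpace (𝓡 3) x) : A = ∑ m, D.h.inner x A (F m x) • F m x := by
  -- compare the functionals `h(A, ·)` and `h(Σ h(A,Fₘ)Fₘ, ·)` on the frame, then use
  -- non-degeneracy of `h_x`
  have hfun : (D.h.inner x A : TangentSpace (𝓡 3) x →L[ℝ] ℝ) =
      D.h.inner x (∑ m, D.h.inner x A (F m x) • F m x) := by
    refine SenParallel.clm_eq_of_frame D horth _ _ fun j ↦ ?_
    simp only [map_sum, map_smul, _root_.sum_apply, FunLike.coe_smul, Pi.smul_apply,
      smul_eq_mul, horth, mul_ite, mul_one, mul_zero, Finset.sum_ite_eq', Finset.mem_univ,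
      if_true]
  have hR := D.isRiemannian_metric
  by_contra hne
  have hpos := hR x (A - ∑ m, D.h.inner x A (F m x) • F m x) (sub_ne_zero.mpr hne)
  have hzero : D.h.inner x (A - ∑ m, D.h.inner x A (F m x) • F m x) = 0 := by
    rw [map_sub, sub_eq_zero]
    exact hfun
  rw [D.val_metric, hzero] at hpos
  simp at hpos

/-- **Parseval in the orthonormal frame**: `h(A, B) = Σₘ h(A, Fₘ) h(B, Fₘ)`. [folklore] -/
theorem val_eq_sum_frame {x : X}
    (horth : ∀ i j, D.h.inner x (F i x) (F j x) = if i = j then 1 else 0)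
    (A B : TangentSpace (𝓡 3) x) :
    D.h.inner x A B = ∑ m, D.h.inner x A (F m x) * D.h.inner x B (F m x) := by
  conv_lhs => rw [eq_sum_frame D F horth B]
  simp only [map_sum, map_smul, smul_eq_mul]
  refine Finset.sum_congr rfl fun m _ ↦ ?_
  ring

/-! ### The structure equation -/

section Structure

variable [D.metric.HasLeviCivita]

/-- **Cartan's second structure equation in an orthonormal frame.** For smooth vector fields
`U`, `W` and a smooth orthonormal frame `F` with connection coefficients `ω_{kl}(v) = h(∇ᵥF_k, F_l)`:
`U(ω_{kl}(W)) − W(ω_{kl}(U)) − ω_{kl}([U,W]) = h(R(U,W)F_k, F_l)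
  + Σₘ (ω_{km}(W) ω_{lm}(U) − ω_{km}(U) ω_{lm}(W))` at every point
(`R(U,W)Z = ∇_U∇_WZ − ∇_W∇_UZ − ∇_{[U,W]}Z`, O'Neill's convention; metric compatibility and
Parseval produce the quadratic terms). O'Neill 1983, Ch. 3, Lemma 3.35 and Thm. 3.11 (D4);
the Cartan form `dω = −ω∧ω + Ω`. [cite: ONeill1983, Ch. 3, Lemma 3.35] -/
theorem structure_equation
    (hF : ∀ i, ContMDiff (𝓡 3) ((𝓡 3).prod 𝓘(ℝ, E3)) ∞
      (fun y ↦ (TotalSpace.mk' E3 y (F i y) : TangentBundle (𝓡 3) X)))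
    (horth : ∀ x i j, D.h.inner x (F i x) (F j x) = if i = j then 1 else 0)
    {U W : Π x : X, TangentSpace (𝓡 3) x}
    (hU : ContMDiff (𝓡 3) ((𝓡 3).prod 𝓘(ℝ, E3)) ∞
      (fun y ↦ (TotalSpace.mk' E3 y (U y) : TangentBundle (𝓡 3) X)))
    (hW : ContMDiff (𝓡 3) ((𝓡 3).prod 𝓘(ℝ, E3)) ∞
      (fun y ↦ (TotalSpace.mk' E3 y (W y) : TangentBundle (𝓡 3) X)))
    (k l : Fin 3) (x : X) :
    mvfderiv (𝓡 3) (fun y ↦ connCoeff D F k l y (W y)) x (U x) -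
        mvfderiv (𝓡 3) (fun y ↦ connCoeff D F k l y (U y)) x (W x) -
        connCoeff D F k l x (mlieBracket (𝓡 3) U W x) =
      D.metric.val x (D.metric.riemann x (U x) (W x) (F k x)) (F l x) +
        ∑ m, (connCoeff D F k m x (W x) * connCoeff D F l m x (U x) -
          connCoeff D F k m x (U x) * connCoeff D F l m x (W x)) := by
  -- the fields `Z^V := ∇_V F_k` are smooth
  set ZW : Π y : X, TangentSpace (𝓡 3) y := fun y ↦ D.metric.leviCivita (F k) y (W y) with hZW
  set ZU : Π y : X, TangentSpace (𝓡 3) y := fun y ↦ D.metric.leviCivita (F k) y (U y) with hZU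
  have hZWs : ContMDiff (𝓡 3) ((𝓡 3).prod 𝓘(ℝ, E3)) ∞
      (fun y ↦ (TotalSpace.mk' E3 y (ZW y) : TangentBundle (𝓡 3) X)) := fun y ↦
    contMDiffAt_leviCivita_apply D (hF k) (hW y)
  have hZUs : ContMDiff (𝓡 3) ((𝓡 3).prod 𝓘(ℝ, E3)) ∞
      (fun y ↦ (TotalSpace.mk' E3 y (ZU y) : TangentBundle (𝓡 3) X)) := fun y ↦
    contMDiffAt_leviCivita_apply D (hF k) (hU y)
  have hLC := PseudoRiemannianMetric.isLeviCivita_leviCivita_holds (g := D.metric)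
  have hcompat : D.metric.IsCompatible D.metric.leviCivita := hLC.2
  have hmd : ∀ {V : Π y : X, TangentSpace (𝓡 3) y},
      ContMDiff (𝓡 3) ((𝓡 3).prod 𝓘(ℝ, E3)) ∞
        (fun y ↦ (TotalSpace.mk' E3 y (V y) : TangentBundle (𝓡 3) X)) →
      ∀ y, MDifferentiableAt (𝓡 3) ((𝓡 3).prod 𝓘(ℝ, E3))
        (fun y ↦ (TotalSpace.mk' E3 y (V y) : TangentBundle (𝓡 3) X)) y :=
    fun hV y ↦ (hV y).mdifferentiableAt (by simp)
  -- metric compatibility: `U h(Z^W, F_l) = h(∇_U Z^W, F_l) + h(Z^W, ∇_U F_l)`, and with `U ↔ W`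
  have h1 : mvfderiv (𝓡 3) (fun y ↦ connCoeff D F k l y (W y)) x (U x) =
      D.metric.val x (D.metric.leviCivita ZW x (U x)) (F l x) +
        D.metric.val x (ZW x) (D.metric.leviCivita (F l) x (U x)) :=
    hcompat (hmd hU x) (hmd hZWs x) (hmd (hF l) x)
  have h2 : mvfderiv (𝓡 3) (fun y ↦ connCoeff D F k l y (U y)) x (W x) =
      D.metric.val x (D.metric.leviCivita ZU x (W x)) (F l x) +
        D.metric.val x (ZU x) (D.metric.leviCivita (F l) x (W x)) :=
    hcompat (hmd hW x) (hmd hZUs x) (hmd (hF l) x)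
  -- the curvature on smooth fields
  have hcov1 : D.metric.leviCivita.IsLocallyContMDiff 1 :=
    D.metric.isLocallyContMDiff_leviCivita_holds 1 (by exact_mod_cast le_top)
  have hI3 : IsManifold (𝓡 3) (minSmoothness ℝ 3) X := by
    rw [minSmoothness_of_isRCLikeNormedField]; infer_instance
  have hcurv : D.metric.riemann x (U x) (W x) (F k x) =
      D.metric.leviCivita ZW x (U x) - D.metric.leviCivita ZU x (W x) -
        D.metric.leviCivita (F k) x (mlieBracket (𝓡 3) U W x) :=
    CovariantDerivative.curvature_apply_holds (cov := D.metric.leviCivita) (x := x)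
      hcov1 (hmd hU x) (hmd hW x)
      ((hF k x).of_le (by rw [minSmoothness_of_isRCLikeNormedField]; exact WithTop.coe_le_coe.2 le_top))
  -- Parseval for the quadratic terms
  have hP1 : D.metric.val x (ZW x) (D.metric.leviCivita (F l) x (U x)) =
      ∑ m, connCoeff D F k m x (W x) * connCoeff D F l m x (U x) := by
    rw [D.val_metric, val_eq_sum_frame D F (horth x)]
    rfl
  have hP2 : D.metric.val x (ZU x) (D.metric.leviCivita (F l) x (W x)) =
      ∑ m, connCoeff D F k m x (U x) * connCoeff D F l m x (W x) := by
    rw [D.val_metric, val_eq_sum_frame D F (horth x)]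
    rfl
  rw [h1, h2, hcurv, hP1, hP2, connCoeff_apply]
  simp only [map_sub, FunLike.coe_sub, Pi.sub_apply, Finset.sum_sub_distrib]
  ring

end Structure

/-! ### The bracket of second derivatives of a vector-valued function -/

/-- **`U(Wψ) − W(Uψ) = [U, W]ψ` for vector-valued `ψ`.** For a spinor field `ψ` of class `C²`
at `x` and vector fields `U`, `W` of class `C²` at `x`,
`d(y ↦ dψ_y(W_y))_x(U_x) − d(y ↦ dψ_y(U_y))_x(W_x) = dψ_x([U,W]_x)` (apply the scalar statement
`mvfderiv_apply_mlieBracket` to the coordinates of `ψ`). Gallot–Hulin–Lafontaine 2004,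
Def. 1.52 bis. [cite: GallotHulinLafontaine2004, Def. 1.52 bis] -/
theorem mvfderiv_mvfderiv_sub_eq_mvfderiv_mlieBracket {ψ : X → Spinor} {x : X}
    (hψ : ContMDiffAt (𝓡 3) 𝓘(ℝ, Spinor) 2 ψ x)
    {U W : Π x : X, TangentSpace (𝓡 3) x}
    (hU : ContMDiffAt (𝓡 3) ((𝓡 3).prod 𝓘(ℝ, E3)) 2
      (fun y ↦ (TotalSpace.mk' E3 y (U y) : TangentBundle (𝓡 3) X)) x)
    (hW : ContMDiffAt (𝓡 3) ((𝓡 3).prod 𝓘(ℝ, E3)) 2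
      (fun y ↦ (TotalSpace.mk' E3 y (W y) : TangentBundle (𝓡 3) X)) x) :
    mvfderiv (𝓡 3) (fun y ↦ mvfderiv (𝓡 3) ψ y (W y)) x (U x) -
        mvfderiv (𝓡 3) (fun y ↦ mvfderiv (𝓡 3) ψ y (U y)) x (W x) =
      mvfderiv (𝓡 3) ψ x (mlieBracket (𝓡 3) U W x) := by
  -- test against the coordinate functionals `ℓ_a u = u a`
  have hcoord : ∀ u v : Spinor, (∀ a : Fin 4, (EuclideanSpace.proj a : Spinor →L[ℝ] ℝ) u =
      (EuclideanSpace.proj a : Spinor →L[ℝ] ℝ) v) → u = v := by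
    intro u v h
    ext a
    exact h a
  apply hcoord
  intro a
  set ℓ : Spinor →L[ℝ] ℝ := EuclideanSpace.proj a with hℓ
  -- `ℓ ∘ ψ` is `C²`, and its derivatives along fields are `ℓ` of those of `ψ`
  have hℓψ : ContMDiffAt (𝓡 3) 𝓘(ℝ, ℝ) 2 (fun y ↦ ℓ (ψ y)) x :=
    ℓ.contDiff.contDiffAt.comp_contMDiffAt hψ
  have hψd : ∀ᶠ y in 𝓝 x, MDifferentiableAt (𝓡 3) 𝓘(ℝ, Spinor) ψ y := by
    have h := (contMDiffAt_iff_contMDiffAt_nhds (by decide)).mp hψ  -- `C²` near `x`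
    filter_upwards [h] with y hy using hy.mdifferentiableAt (by simp)
  have hderiv : ∀ V : Π y : X, TangentSpace (𝓡 3) y,
      (fun y ↦ mvfderiv (𝓡 3) (fun z ↦ ℓ (ψ z)) y (V y)) =ᶠ[𝓝 x]
        fun y ↦ ℓ (mvfderiv (𝓡 3) ψ y (V y)) := by
    intro V
    filter_upwards [hψd] with y hy
    rw [SenParallel.mvfderiv_clm_apply_comp ℓ hy]
  have hscalar := Literature.Geometry.Lorentzian.mvfderiv_apply_mlieBracket hℓψ hU hW
  -- left-hand side through `ℓ`
  have hUd : MDifferentiableAt (𝓡 3) 𝓘(ℝ, Spinor) (fun y ↦ mvfderiv (𝓡 3) ψ y (U y)) x :=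
    (VectorField.contMDiffAt_mvfderiv_apply_of_contMDiffAt hψ (hU.of_le one_le_two)
      (by norm_num)).mdifferentiableAt one_ne_zero
  have hWd : MDifferentiableAt (𝓡 3) 𝓘(ℝ, Spinor) (fun y ↦ mvfderiv (𝓡 3) ψ y (W y)) x :=
    (VectorField.contMDiffAt_mvfderiv_apply_of_contMDiffAt hψ (hW.of_le one_le_two)
      (by norm_num)).mdifferentiableAt one_ne_zero
  rw [map_sub, ← SenParallel.mvfderiv_clm_apply_comp ℓ hWd, ← SenParallel.mvfderiv_clm_apply_comp ℓ hUd,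
    ← SenParallel.mvfderiv_clm_apply_comp ℓ (hψ.mdifferentiableAt (by simp))]
  rw [hscalar, Literature.Geometry.Lorentzian.mvfderiv_congr_of_eventuallyEq (hderiv W),
    Literature.Geometry.Lorentzian.mvfderiv_congr_of_eventuallyEq (hderiv U)]

end SenWitten

end Literature.Geometry.Lorentzian

end
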